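import Summits.BirchSwinnertonDyer.BirchSwinnertonDyer.Theorems.ByReductionTypeAtTwoMultTransportTwistedDescentLocalHelpers
import Summits.BirchSwinnertonDyer.BirchSwinnertonDyer.Theorems.ByReductionTypeAtTwoMultTransportTwistedDescentLocalGenerator
import Summits.BirchSwinnertonDyer.BirchSwinnertonDyer.Theorems.ByReductionTypeAtTwoMultTransportTwistedDescentStrictDualControl
import Summits.BirchSwinnertonDyer.BirchSwinnertonDyer.Theorems.ByReductionTypeAtTwoMultTransportTwistedDescentLevelDualAtTwo
import HarnessLib

/-!
# T-42 in the kernel, LXXIX — road (S-C′), brick B2 (iii): the orthogonality ENGINE re-aimed at `S₀ ∪ {2, ∞}` — targets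
# prescribed EXACTLY at the omitted primes `S₀` (structure `𝓕₀ = 𝓕.strictAt S₀`), `u`-eigenvectors controlled in the
# NON-PRIMITIVE Selmer group, and the dual obstruction killed AT THE PLACE ABOVE `2` (LXXVII) instead of at an omitted prime;
# assembled with the Poitou–Tate lift of LXXVI: prescribed local classes at `S₀` are realised by ONE class of `Sel^{Σ₀}(E/ℚ_∞)`

Cell `bsd-2adic` (run/shared/lean/pub/bsd-2adic/), seat `bsd-2adic-t42` GEN 32 (pen RC-521 «(S-C′) FUNDED», memo
`t42/DESIGN-T42-ADDENDUM-35.md` §A35.8). HONEST FRAMING: research route; THEOREMS ONLY (no `def`, no named fact, no instance, no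
`sorry`); nothing booked; no door or class file is touched; BSD is not proved by any of this. PARTITION: X5@2 multiplicative
GV-transport rows (K4ᵐ B1·O1; the PRINT binder F1 = `Matsuno2008.cor23_lemma24_nonPrimitive_invariants_two`) × p = 2 —
reduces-the-named-input-of; bears_on K4 items 19922 / 19923 (`--supports stmt-BirchSwinnertonDyer-19923`).

## What

* **`exists_strict_target_orthogonal_R`** — the twin of XXIV-b′/LXV-g `exists_target_orthogonal_alt_R` for SURJ₂. Inputs (predicate
  `R` threads the reduction type at `2` as in the generic chain): `2^a` kills the `u`-eigenvectors of `conj_γ` in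
  `Sel^{Σ₀}_{2^∞}(E/ℚ_∞)` (`ha`, generic `u` — LXX + LXXIV at `n = 0`), `2^b` kills `E(ℚ_∞)[2^∞]` (`hb`), a Greenberg LINE PACKAGE at
  a place `v₂ ∋ 2` (`N`, (d) `hdiv`, (c) `hcard`, (i) `hKum`, (iv) `hInert` — EXACTLY the tuple delivered by XXXVII
  `exists_tateLine_localKummer_two_inertia` (multiplicative `2`) and LXIII `reductionDatum_linePackage` (good ordinary `2`); the
  inertial `σ₀` over the topological generator is taken from XXXIV `exists_mem_absInertia_kappa_resGal_eq`), the MODEL HYPOTHESIS in its `2`-torsion form `hmod₁` («no `Γ_ℚ`-fixed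
  point of order `2` on the line», i.e. `P₀ ∉ C₂` on the `HasUniqueRationalTwoTorsion` rows, vacuous on `E(ℚ)[2] = 0` rows — k5),
  the two local dual Kummer statements `δ2`, `δinf` (as in LXV-g, alternating pairings), and EVENTUAL local targets at every
  `v ∈ S₀`: `∃ J₀, ∀ J ≥ J₀, ∃ t, twistedTorsionToLocalH1 t = z_v` — LITERALLY the conclusion shape of the tree's twisted local
  `Γ`-descent at `v ∤ p` (`WeierstrassCurve.exists_twistedTorsionToLocalH1_eq_of_zsmul_conjH1_eq`, Literature
  `ZpExtensionGaloisTwistLocalDescentProofs`; RTT twin `SignedEC.TwistedLocalDescent.…`), brick B1. Output: a level `J` and targets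
  `t_v` of level `J` at `v ∈ S₀` mapping to `z_v`, whose local Tate pairings with EVERY `y ∈ H¹_{𝓕₀^*}(ℚ, E[2^J](χ_u)^D)` vanish at
  every `v ∈ S₀`, for every family of local invariant maps with the five printed properties.
  MECHANISM (Greenberg p. 124 + audit-2 D-NOTE SC-NEG@2 §4): `j' = max(sup_{S₀} J₀, |u − 1|, 1)`, `J = j' + a + 2b`, `t = H¹(ι) t'`;
  for `y = H¹(w) y'`: `twistedTorsionToH1 y' ∈ Sel^{Σ₀}_∞` (LXXVIII + `δ2` + `δinf`), so `2^{a+2b} y' = 0`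
  (`ZpExtensionGaloisTwistExponentProofs`); `y ∈ 𝓕₀^*` at `v₂` is the dual Kummer condition, so LXXVII-b gives `H¹(ι^D) y = 0`; hence
  `⟨H¹(ι) t'_v, y_v⟩_v = ⟨t'_v, loc_v H¹(ι^D) y⟩_v = 0` at every `v ∈ S₀`.
* **`exists_mem_nonPrimitiveSelmerInfty_localResOver_eq_R`** — + Poitou–Tate for `ℚ` (the five-property family, hypothesis
  `poitouTate_selmerStructure_duality_real ℚ`, a KERNEL theorem: `SchneiderFreeAdditiveX3…poitouTate_selmerStructure_duality_real_holds`)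
  + LXXVI: the prescribed classes `(z_v)_{v ∈ S₀}` are `(localResOver_v c)` for ONE `c = twistedTorsionToH1 x ∈ Sel^{Σ₀}_{2^∞}(E/ℚ_∞)`,
  an eigenclass of every `conj_σ` — the «fixed families are hit» input of the successor's SurjEngine run (B3), with NO omitted prime,
  NO Prop. 4.9, NO coinvariant input, NO Cassels, and 0 new print.

References: [GreenbergLNM1716] §4 Lemma 4.6/4.7 (pp. 105–109), Prop. 4.13 + Remark, pp. 121–126; [GreenbergVatsal2000] §2 Prop. (2.1)
(pp. 17–19); [MilneADT2006] I Cor. 2.3, Thm. 2.6, Thm. 4.10; [Howard2004HeegnerKolyvagin] Thm. 2.1.11.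
-/

set_option autoImplicit false
set_option linter.dupNamespace false

noncomputable section

open scoped Classical AddSubgroup ContRepresentation

namespace Summit.BirchSwinnertonDyer.BirchSwinnertonDyer.Theorems.MultTransportTwistedDescent

open NumberField IsDedekindDomain Field WeierstrassCurve CategoryTheory
  Literature.NumberTheory.EllipticCurves Literature.NumberTheory.EllipticCurves.GreenbergVatsal2000
  Literature.NumberTheory.EllipticCurves.Greenberg1999 Literature.NumberTheory.EllipticCurves.GreenbergSelmer
  Literature.NumberTheory.GaloisRepresentations Literature.NumberTheory.GaloisCohomology
  Summit.BirchSwinnertonDyer.BirchSwinnertonDyer.Theorems.MultTransportAtTwo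
  Summit.BirchSwinnertonDyer.Rank1Residual.X2
open Literature.NumberTheory.GaloisRepresentations.DiscreteGaloisModule (localTatePairingZMod
  unramifiedSubgroup SelmerStructure TateDual)

variable (W : WeierstrassCurve ℚ) [W.IsElliptic] (κ : ZpExtension ℚ 2)

/-- **The orthogonality engine with EXACT targets at `S₀` (one `u`).** See the module docstring for the inputs and the mechanism.
[cite: GreenbergLNM1716, §4 pp. 122–126] [cite: GreenbergVatsal2000, §2 Prop. (2.1) (pp. 17–19)] [cite: MilneADT2006, Ch. I, Thm. 4.10(b)] -/
theorem exists_strict_target_orthogonal_R (R : ∀ (W : WeierstrassCurve ℚ) [W.IsElliptic] [W.IsGloballyMinimal], Prop)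
    [W.IsGloballyMinimal] (hW : R W)
    (hκ : κ.IsCyclotomic) {γ : absoluteGaloisGroup ℚ} (hγ : κ.IsTopGenerator γ)
    (S₀ : Finset (HeightOneSpectrum (𝓞 ℚ))) (hS₀ : ∀ v ∈ S₀, ((2 : ℕ) : 𝓞 ℚ) ∉ v.asIdeal)
    (hbad : ∀ v : HeightOneSpectrum (𝓞 ℚ), v ∉ S₀ → ((2 : ℕ) : 𝓞 ℚ) ∉ v.asIdeal → W.HasGoodReductionAt v)
    {u : ℤ} (hu : (2 : ℤ) ∣ u - 1) (hu1 : u ≠ 1)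
    {a : ℕ} (ha : ∀ s ∈ nonPrimitiveSelmerInfty W κ (↑S₀ : Set (HeightOneSpectrum (𝓞 ℚ))),
      W.conjH1 2 κ.kerSubgroup γ s = u • s → 2 ^ a • s = 0)
    {b : ℕ} (hb : ∀ P : W.geomPrimaryTorsion 2, (∀ h : κ.kerSubgroup, h • P = P) → 2 ^ b • P = 0)
    {v₂ : HeightOneSpectrum (𝓞 ℚ)} (hv₂ : ((2 : ℕ) : 𝓞 ℚ) ∈ v₂.asIdeal)
    (N : LocalDatum ℚ (W.geomPrimaryTorsion 2) v₂)
    (hdiv : ∀ c ∈ N.plus, ∃ c' ∈ N.plus, 2 • c' = c)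
    (hcard : Nat.card ↥(N.plus ⊓ (↥(W.geomPrimaryTorsion 2))[(2 : ℤ)]) = 2)
    (hKum : ∀ (f : localSubgroup κ.kerSubgroup (v₂.adicCompletion ℚ) → W.geomPrimaryTorsion 2),
      (∀ τ, f τ ∈ N.plus) → Continuous f →
      (∀ τ₁ τ₂, f (τ₁ * τ₂) = f τ₁ + resGal (K := ℚ) (v₂.adicCompletion ℚ)
        (τ₁ : absoluteGaloisGroup (v₂.adicCompletion ℚ)) • f τ₂) →
      ∃ Q : localPoints W (v₂.adicCompletion ℚ),
        ∀ τ : localSubgroup κ.kerSubgroup (v₂.adicCompletion ℚ),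
          pointsMap W (v₂.adicCompletion ℚ) (f τ : W.geomPoints) =
            (τ : absoluteGaloisGroup (v₂.adicCompletion ℚ)) • Q - Q)
    (hInert : ∀ σ ∈ absInertia (v₂.adicCompletion ℚ), ∀ (n a : ℕ),
      (∀ ζ : (AlgebraicClosure (v₂.adicCompletion ℚ))ˣ, ζ ^ 2 ^ n = 1 →
        Units.map (Field.absoluteGaloisGroup.toAlgEquiv (v₂.adicCompletion ℚ) σ :
          AlgebraicClosure (v₂.adicCompletion ℚ) →* AlgebraicClosure (v₂.adicCompletion ℚ)) ζ = ζ ^ a) →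
      ∀ c ∈ N.plus, 2 ^ n • c = 0 → resGal (K := ℚ) (v₂.adicCompletion ℚ) σ • c = a • c)
    (hmod₁ : ∀ P ∈ N.plus, 2 • P = 0 → (∀ g : absoluteGaloisGroup ℚ, g • P = P) → P = 0)
    (δ2 : ∀ (W : WeierstrassCurve ℚ) [W.IsElliptic] [W.IsGloballyMinimal],
      R W →
      ∀ (κ : ZpExtension ℚ 2) (_hκ : κ.IsCyclotomic) (J : ℕ) (u u' : ℤ) (hu : (2 : ℤ) ∣ u - 1)
        (hu' : (2 : ℤ) ∣ u' - 1) (huu' : ((2 : ℤ) ^ J) ∣ u * u' - 1)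
        (e : W.geomTorsion ((2 ^ J : ℕ) : ℤ) → W.geomTorsion ((2 ^ J : ℕ) : ℤ) → AlgebraicClosure ℚ)
        (hμ : ∀ S T, e S T ^ (2 ^ J) = 1)
        (hadd₁ : ∀ S₁ S₂ T, e (S₁ + S₂) T = e S₁ T * e S₂ T)
        (hadd₂ : ∀ S T₁ T₂, e S (T₁ + T₂) = e S T₁ * e S T₂)
        (hgal : ∀ (σ : absoluteGaloisGroup ℚ) (S T : W.geomTorsion ((2 ^ J : ℕ) : ℤ)),
          σ • e S T = e (σ • S) (σ • T))
        (_halt : ∀ T, e T T = 1) (_hnondeg : ∀ T, (∀ S, e S T = 1) → T = 0),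
      ∀ [Finite (W.geomTorsion ((2 ^ J : ℕ) : ℤ))],
      ∀ (v : HeightOneSpectrum (𝓞 ℚ)), ((2 : ℕ) : 𝓞 ℚ) ∈ v.asIdeal →
      ∀ (ιv : galoisCohomology ((DiscreteGaloisModule.mu ℚ (2 ^ J)).toLocal (Sum.inr v)) 2 →+ ZMod (2 ^ J)),
        Function.Bijective ιv →
      ∀ (y' : galoisCohomology
          ((W.twistedTorsionGaloisModule 2 κ J u' hu').restrictField (v.adicCompletion ℚ)) 1),
        (∀ a : galoisCohomology
            ((W.twistedTorsionGaloisModule 2 κ J u hu).restrictField (v.adicCompletion ℚ)) 1,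
          W.twistedTorsionToLocalH1 2 κ J u hu (v.adicCompletion ℚ) a = 0 →
          localTatePairingZMod (W.twistedTorsionGaloisModule 2 κ J u hu) (2 ^ J) (Sum.inr v) ιv a
            (galoisCohomology.map
              ((W.twistedWeilDual 2 κ J hu hu' huu' e hμ hadd₁ hadd₂ hgal).restrictField
                (v.adicCompletion ℚ)) 1 y') = 0) →
        W.twistedTorsionToLocalH1 2 κ J u' hu' (v.adicCompletion ℚ) y' = 0)
    (δinf : ∀ (W : WeierstrassCurve ℚ) [W.IsElliptic] [W.IsGloballyMinimal],
      R W →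
      ∀ (κ : ZpExtension ℚ 2) (_hκ : κ.IsCyclotomic) (J : ℕ) (u u' : ℤ) (hu : (2 : ℤ) ∣ u - 1)
        (hu' : (2 : ℤ) ∣ u' - 1) (huu' : ((2 : ℤ) ^ J) ∣ u * u' - 1)
        (e : W.geomTorsion ((2 ^ J : ℕ) : ℤ) → W.geomTorsion ((2 ^ J : ℕ) : ℤ) → AlgebraicClosure ℚ)
        (hμ : ∀ S T, e S T ^ (2 ^ J) = 1)
        (hadd₁ : ∀ S₁ S₂ T, e (S₁ + S₂) T = e S₁ T * e S₂ T)
        (hadd₂ : ∀ S T₁ T₂, e S (T₁ + T₂) = e S T₁ * e S T₂)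
        (hgal : ∀ (σ : absoluteGaloisGroup ℚ) (S T : W.geomTorsion ((2 ^ J : ℕ) : ℤ)),
          σ • e S T = e (σ • S) (σ • T))
        (_halt : ∀ T, e T T = 1) (_hnondeg : ∀ T, (∀ S, e S T = 1) → T = 0),
      ∀ [Finite (W.geomTorsion ((2 ^ J : ℕ) : ℤ))],
      ∀ (w : InfinitePlace ℚ)
        (ιw : galoisCohomology ((DiscreteGaloisModule.mu ℚ (2 ^ J)).toLocal (Sum.inl w)) 2 →+ ZMod (2 ^ J)),
        Function.Injective ιw →
      ∀ (y' : galoisCohomology ((W.twistedTorsionGaloisModule 2 κ J u' hu').restrictField w.Completion) 1),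
        (∀ a : galoisCohomology ((W.twistedTorsionGaloisModule 2 κ J u hu).restrictField w.Completion) 1,
          W.twistedTorsionToLocalH1 2 κ J u hu w.Completion a = 0 →
          localTatePairingZMod (W.twistedTorsionGaloisModule 2 κ J u hu) (2 ^ J) (Sum.inl w) ιw a
            (galoisCohomology.map
              ((W.twistedWeilDual 2 κ J hu hu' huu' e hμ hadd₁ hadd₂ hgal).restrictField w.Completion)
              1 y') = 0) →
        W.twistedTorsionToLocalH1 2 κ J u' hu' w.Completion y' = 0)
    (z : Π v : HeightOneSpectrum (𝓞 ℚ),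
      discreteH1 (localSubgroup κ.kerSubgroup (v.adicCompletion ℚ)) (localPoints W (v.adicCompletion ℚ)))
    (hT₀ : ∀ v ∈ S₀, ∃ J₀ : ℕ, ∀ J : ℕ, J₀ ≤ J →
      ∃ t : galoisCohomology ((W.twistedTorsionGaloisModule 2 κ J u hu).restrictField (v.adicCompletion ℚ)) 1,
        W.twistedTorsionToLocalH1 2 κ J u hu (v.adicCompletion ℚ) t = z v) :
    ∃ (J : ℕ)
      (t : Π v : HeightOneSpectrum (𝓞 ℚ),
        galoisCohomology ((W.twistedTorsionGaloisModule 2 κ J u hu).restrictField (v.adicCompletion ℚ)) 1),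
      (∀ v ∈ S₀, W.twistedTorsionToLocalH1 2 κ J u hu (v.adicCompletion ℚ) (t v) = z v) ∧
      (∀ [Finite (W.geomTorsion ((2 ^ J : ℕ) : ℤ))] (inv : LocalInvariants ℚ (2 ^ J)),
          inv.IsPerfect → inv.SumLocalTermEqZero → inv.UnramifiedOrthogonal → inv.SelmerComplement →
          inv.InjectiveAtRealPlaces →
        ∀ y ∈ (inv.dualSelmerStructure (W.twistedTorsionGaloisModule 2 κ J u hu)
            ((W.twistedKummerSelmerStructure 2 S₀ κ J u hu).strictAt S₀)).selmerGroup,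
          ∀ v ∈ S₀,
            localTatePairingZMod (W.twistedTorsionGaloisModule 2 κ J u hu) (2 ^ J) (Sum.inr v) (inv (Sum.inr v)) (t v)
              (galoisCohomology.localization ((W.twistedTorsionGaloisModule 2 κ J u hu).tateDual (2 ^ J))
                (Sum.inr v) 1 y) = 0) := by
  haveI : Fact (Nat.Prime 2) := ⟨Nat.prime_two⟩
  have hdivE : W.zsmul_geomPoints_surjective := zsmul_geomPoints_surjective_holds W
  -- the inertial `σ₀` over the topological generator at `v₂` (XXXIV) and the package clause (iv) for it
  obtain ⟨σ₀, hσ₀I, hσ₀⟩ := exists_mem_absInertia_kappa_resGal_eq 2 κ hκ hv₂ γ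
  rw [show κ γ = Multiplicative.ofAdd 1 from hγ] at hσ₀
  have hσ₀N := hInert σ₀ hσ₀I
  -- levels: `j' ≥ J₀(v)` for `v ∈ S₀`, `j' ≥ |u - 1|`, `j' ≥ 1`; `J = j' + a + 2b`
  have hT' : ∀ v : HeightOneSpectrum (𝓞 ℚ), ∃ J₀ : ℕ, v ∈ S₀ → ∀ J : ℕ, J₀ ≤ J →
      ∃ t : galoisCohomology ((W.twistedTorsionGaloisModule 2 κ J u hu).restrictField (v.adicCompletion ℚ)) 1,
        W.twistedTorsionToLocalH1 2 κ J u hu (v.adicCompletion ℚ) t = z v := by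
    intro v
    by_cases hv : v ∈ S₀
    · obtain ⟨J₀, hJ₀⟩ := hT₀ v hv
      exact ⟨J₀, fun _ ↦ hJ₀⟩
    · exact ⟨0, fun h ↦ absurd h hv⟩
  choose J₀ hJ₀ using hT'
  set j' : ℕ := max (max (S₀.sup J₀) (u - 1).natAbs) 1 with hj'
  have hJ₀j : ∀ v ∈ S₀, J₀ v ≤ j' := fun v hv ↦
    (Finset.le_sup (f := J₀) hv).trans ((le_max_left _ _).trans (le_max_left _ _))
  have huj : (u - 1).natAbs ≤ j' := (le_max_right _ _).trans (le_max_left _ _)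
  have h1j : 1 ≤ j' := le_max_right _ _
  set ee : ℕ := a + b + b with hee
  set J : ℕ := j' + ee with hJdef
  have hjJ : j' ≤ J := Nat.le_add_right _ _
  have hJsub : J - j' = ee := by omega
  have h1J : 1 ≤ J := h1j.trans hjJ
  -- `u'` inverse to `u` modulo `2^J`
  obtain ⟨u', hu', huu'⟩ := exists_odd_inverse_mod_two_pow hu J
  -- a Weil pairing at level `2^J`
  obtain ⟨e, hμ, hadd₁, hadd₂, halt, hnondeg, hgal⟩ := WeierstrassCurve.exists_weilPairing_holds W (2 ^ J)
    (by calc (2 : ℕ) = 2 ^ 1 := (pow_one 2).symm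
      _ ≤ 2 ^ J := Nat.pow_le_pow_right (by norm_num) h1J)
    (by exact_mod_cast pow_ne_zero J (two_ne_zero))
  haveI hFj : Finite (W.geomTorsion ((2 ^ j' : ℕ) : ℤ)) :=
    haveI : NeZero (2 ^ j') := ⟨pow_ne_zero _ two_ne_zero⟩; finite_geomTorsion_of_neZero W (2 ^ j')
  haveI hFJ : Finite (W.geomTorsion ((2 ^ J : ℕ) : ℤ)) :=
    haveI : NeZero (2 ^ J) := ⟨pow_ne_zero _ two_ne_zero⟩; finite_geomTorsion_of_neZero W (2 ^ J)
  -- targets at level `j'` at the places of `S₀` (the eventual local lifts, brick B1)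
  have hT'' : ∀ v : HeightOneSpectrum (𝓞 ℚ), ∃ t' : galoisCohomology
      ((W.twistedTorsionGaloisModule 2 κ j' u hu).restrictField (v.adicCompletion ℚ)) 1,
      v ∈ S₀ → W.twistedTorsionToLocalH1 2 κ j' u hu (v.adicCompletion ℚ) t' = z v := by
    intro v
    by_cases hv : v ∈ S₀
    · obtain ⟨t, ht⟩ := hJ₀ v hv j' (hJ₀j v hv)
      exact ⟨t, fun _ ↦ ht⟩
    · exact ⟨0, fun h ↦ absurd h hv⟩
  choose t' ht' using hT''
  -- the target family at level `J`
  let t : Π v : HeightOneSpectrum (𝓞 ℚ),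
      galoisCohomology ((W.twistedTorsionGaloisModule 2 κ J u hu).restrictField (v.adicCompletion ℚ)) 1 := fun v ↦
    galoisCohomology.map ((W.twistedTorsionIncl 2 κ hjJ u hu).restrictField (v.adicCompletion ℚ)) 1 (t' v)
  have ht_def : ∀ v, t v =
      galoisCohomology.map ((W.twistedTorsionIncl 2 κ hjJ u hu).restrictField (v.adicCompletion ℚ)) 1 (t' v) :=
    fun _ ↦ rfl
  refine ⟨J, t, fun v hv ↦ ?_, ?_⟩
  · -- the targets hit `z`
    rw [ht_def v, W.twistedTorsionToLocalH1_map_incl 2 κ hjJ u hu (v.adicCompletion ℚ) (t' v)]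
    exact ht' v hv
  -- ORTHOGONALITY
  intro _instJ inv hperf hsum hUO hSC hreal y hy v hv
  set wJ := W.twistedWeilDual 2 κ J hu hu' huu' e hμ hadd₁ hadd₂ hgal with hwJ
  -- read `y` in `E[2^J](χ_{u'})`
  set y' := galoisCohomology.map (W.twistedWeilDualInv 2 κ J hu hu' huu' e hμ hadd₁ hadd₂ hgal hnondeg) 1 y
    with hy'def
  have hyy' : galoisCohomology.map wJ 1 y' = y :=
    W.map_twistedWeilDual_map_inv 2 κ J hu hu' huu' e hμ hadd₁ hadd₂ hgal hnondeg y
  have hy₁ : galoisCohomology.map wJ 1 y' ∈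
      (inv.dualSelmerStructure (W.twistedTorsionGaloisModule 2 κ J u hu)
        ((W.twistedKummerSelmerStructure 2 S₀ κ J u hu).strictAt S₀)).selmerGroup := by rw [hyy']; exact hy
  have hS : ∀ v : HeightOneSpectrum (𝓞 ℚ), (Sum.inr v : Place ℚ) ∉ twistedDescentPlaces (K := ℚ) 2 S₀ →
      ((2 ^ J : ℕ) : 𝓞 ℚ) ∉ v.asIdeal ∧
        GaloisRep.IsUnramifiedAt v (W.twistedTorsionGaloisModule 2 κ J u hu) := fun v hv ↦ by
    rw [not_mem_twistedDescentPlaces_iff] at hv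
    exact W.natCast_pow_not_mem_and_isUnramifiedAt_twistedTorsionGaloisModule 2 κ J u hu
      (S₀ := (↑S₀ : Set (HeightOneSpectrum (𝓞 ℚ)))) (fun v hv' hpv ↦ hbad v (by exact_mod_cast hv') hpv)
      (by exact_mod_cast hv.1) hv.2
  -- the local terms of `y` vanish on the kernels at `2` and `∞` (definition of `𝓕₀^*` off `S₀`)
  have hy_mem := hy
  rw [SelmerStructure.mem_selmerGroup_iff] at hy_mem
  have hker2 : ∀ v : HeightOneSpectrum (𝓞 ℚ), ((2 : ℕ) : 𝓞 ℚ) ∈ v.asIdeal →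
      ∀ a' : galoisCohomology ((W.twistedTorsionGaloisModule 2 κ J u hu).restrictField (v.adicCompletion ℚ)) 1,
        W.twistedTorsionToLocalH1 2 κ J u hu (v.adicCompletion ℚ) a' = 0 →
        localTatePairingZMod (W.twistedTorsionGaloisModule 2 κ J u hu) (2 ^ J) (Sum.inr v) (inv (Sum.inr v)) a'
          (galoisCohomology.map (wJ.restrictField (v.adicCompletion ℚ)) 1
            (galoisCohomology.res (W.twistedTorsionGaloisModule 2 κ J u' hu') (v.adicCompletion ℚ) 1 y')) = 0 := by
    intro v hv a' ha'
    have hvS : v ∉ S₀ := fun h ↦ hS₀ v h hv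
    have hyv := hy_mem (Sum.inr v)
    rw [LocalInvariants.dualSelmerStructure_apply, strictKummer_inr_of_mem_asIdeal W 2 S₀ κ J u hu hvS hv,
      LocalInvariants.mem_dualLocalCondition_iff] at hyv
    rw [← W.res_map_twistedWeilDual 2 κ J hu hu' huu' e hμ hadd₁ hadd₂ hgal (v.adicCompletion ℚ) y', hyy']
    exact hyv a' ha'
  have hkerinf : ∀ w : InfinitePlace ℚ,
      ∀ a' : galoisCohomology ((W.twistedTorsionGaloisModule 2 κ J u hu).restrictField w.Completion) 1,
        W.twistedTorsionToLocalH1 2 κ J u hu w.Completion a' = 0 →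
        localTatePairingZMod (W.twistedTorsionGaloisModule 2 κ J u hu) (2 ^ J) (Sum.inl w) (inv (Sum.inl w)) a'
          (galoisCohomology.map (wJ.restrictField w.Completion) 1
            (galoisCohomology.res (W.twistedTorsionGaloisModule 2 κ J u' hu') w.Completion 1 y')) = 0 := by
    intro w a' ha'
    have hyw := hy_mem (Sum.inl w)
    rw [LocalInvariants.dualSelmerStructure_apply, strictKummer_inl W 2 S₀ κ J u hu,
      LocalInvariants.mem_dualLocalCondition_iff] at hyw
    rw [← W.res_map_twistedWeilDual 2 κ J hu hu' huu' e hμ hadd₁ hadd₂ hgal w.Completion y', hyy']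
    exact hyw a' ha'
  -- dual-side control: `twistedTorsionToH1 y' ∈ Sel^{Σ₀}_∞` (LXXVIII + `δ2` + `δinf`)
  have hSel : W.twistedTorsionToH1 2 κ J u' hu' y' ∈ nonPrimitiveSelmerInfty W κ (↑S₀ : Set (HeightOneSpectrum (𝓞 ℚ))) :=
    twistedTorsionToH1_mem_nonPrimitiveSelmerInfty_of_mem_dualSelmer_strict W 2 κ S₀ J hu hu' huu' e hμ hadd₁ hadd₂
      hgal hnondeg hκ hS hUO y' hy₁
      (fun v hv ↦ δ2 W hW κ hκ J u u' hu hu' huu' e hμ hadd₁ hadd₂ hgal halt hnondeg v hv (inv (Sum.inr v))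
        (hperf v).1 _ (hker2 v hv))
      (fun w ↦ δinf W hW κ hκ J u u' hu hu' huu' e hμ hadd₁ hadd₂ hgal halt hnondeg w (inv (Sum.inl w))
        (hreal.injective (NumberField.IsTotallyReal.isReal w)) _ (hkerinf w))
  -- hence `2^{a+2b} y' = 0`, i.e. `2^{J-j'} y' = 0`
  have hey' : 2 ^ ee • y' = 0 :=
    W.pow_smul_eq_zero_of_twistedTorsionToH1_mem 2 κ J hu' huu' hγ hb
      (nonPrimitiveSelmerInfty W κ (↑S₀ : Set (HeightOneSpectrum (𝓞 ℚ)))) ha y' hSel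
  have hey : (2 ^ (J - j')) • y' = 0 := by rw [hJsub]; exact hey'
  -- the line package at `v₂` at level `J`, and the model hypothesis at level `J` for the twist `u'`
  have hv₂S : v₂ ∉ S₀ := fun h ↦ hS₀ v₂ h hv₂
  have hσ₀C : ∀ a : ℕ, (∀ ζ : (AlgebraicClosure (v₂.adicCompletion ℚ))ˣ, ζ ^ 2 ^ J = 1 →
      Units.map (Field.absoluteGaloisGroup.toAlgEquiv (v₂.adicCompletion ℚ) σ₀ :
        AlgebraicClosure (v₂.adicCompletion ℚ) →* AlgebraicClosure (v₂.adicCompletion ℚ)) ζ = ζ ^ a) →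
      ∀ c : W.geomTorsion ((2 ^ J : ℕ) : ℤ), AddSubgroup.inclusion
        (Literature.Barriers.BirchSwinnertonDyer.geomTorsion_pow_le_geomPrimaryTorsion W 2 J) c ∈ N.plus →
        absGaloisRestrict ℚ (v₂.adicCompletion ℚ) σ₀ • c = a • c := by
    intro a ha c hc
    have h := hσ₀N J a ha _ hc (by rw [← map_nsmul, W.pow_nsmul_geomTorsion_pow 2 J c, map_zero])
    apply Subtype.ext
    have h' := congrArg (fun x : W.geomPrimaryTorsion 2 ↦ (x : W.geomPoints)) h
    simp only [primaryComponent.coe_smul, AddSubgroup.coe_inclusion] at h'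
    rw [Literature.NumberTheory.EllipticCurves.AddSubgroup.torsionBy.coe_smul, ← WeierstrassCurve.resGal_eq_absGaloisRestrict,
      AddSubmonoidClass.coe_nsmul]
    exact h'
  have hmod : ∀ Rpt : W.geomTorsion ((2 ^ J : ℕ) : ℤ), AddSubgroup.inclusion
      (Literature.Barriers.BirchSwinnertonDyer.geomTorsion_pow_le_geomPrimaryTorsion W 2 J) Rpt ∈ N.plus →
      (∀ g : absoluteGaloisGroup ℚ, W.twistedTorsionGaloisModule 2 κ J u' hu' g Rpt = Rpt) → Rpt = 0 :=
    fun Rpt hR hfix ↦ forall_twisted_apply_eq_self_line_eq_zero_of_prime_torsion W 2 κ N.plus hmod₁ J hu' Rpt hR hfix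
  -- so `H¹(ι^D) y = 0` (LXXVII-b, the dual Kummer condition of `y` at `v₂`)
  have hιD : galoisCohomology.map (W.twistedTorsionInclDual 2 κ hjJ u hu) 1 y = 0 := by
    rw [← hyy']
    exact map_twistedTorsionInclDual_map_twistedWeilDual_eq_zero_of_dualKummer_line W 2 κ hjJ hu hu' huu' e hμ hadd₁
      hadd₂ hgal halt hnondeg hdivE huj hu1 v₂ N hdiv hcard hKum σ₀ hσ₀ hσ₀C hmod (inv (Sum.inr v₂)) (hperf v₂).1.1
      y' hey (hker2 v₂ hv₂)
  -- the local term at `v ∈ S₀`: `⟨H¹(ι) t'_v, y_v⟩ = ⟨t'_v, loc_v H¹(ι^D) y⟩ = 0`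
  rw [ht_def v]
  refine (W.localTatePairingZMod_map_twistedTorsionIncl 2 κ hjJ u hu (Sum.inr v) (inv (Sum.inr v)) (t' v) _).trans ?_
  have h0 : galoisCohomology.map ((W.twistedTorsionInclDual 2 κ hjJ u hu).restrictField
      (Place.Completion (K := ℚ) (Sum.inr v))) 1
      (galoisCohomology.localization ((W.twistedTorsionGaloisModule 2 κ J u hu).tateDual (2 ^ J))
        (Sum.inr v) 1 y) = 0 := by
    change galoisCohomology.map ((W.twistedTorsionInclDual 2 κ hjJ u hu).restrictField (v.adicCompletion ℚ)) 1
      (galoisCohomology.res ((W.twistedTorsionGaloisModule 2 κ J u hu).tateDual (2 ^ J))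
        (v.adicCompletion ℚ) 1 y) = 0
    rw [← galoisCohomology.res_map_one, hιD, map_zero]
  rw [h0]
  exact map_zero _

end Summit.BirchSwinnertonDyer.BirchSwinnertonDyer.Theorems.MultTransportTwistedDescent

end
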